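import Summits.ValiantsHypothesis.ValiantsHypothesis.Theorems.LacunarySymmetroidMatrixDescartesFiniteSectorSumMasksHigherNine

/-!
# `MatrixDescartes` — line «finite»: m-FOLD SUM BITMASKS, `m = 22, 23` — bridge theorems for the `K = 4` column cells `(22,4)`, `(23,4)`

HONEST FRAMING.  Object-search cell `pub-symmetroid`, seat val-sym-door-p5 g10 (generator of val-sym-door-p5 g8/g9, fourteen sizes up; fold binders typed `(x acc : ℕ)` — same terms, fast elaboration).  HELPER material for the crux item
`stmt-ValiantsHypothesis-18050` with NO closure claim and no mathematical content of its own; continuation of `…FiniteSectorSumMasksHigherNine` (`m = 20, 21`):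
membership ⇒ bit for the twenty-two- and twenty-threefold iterated shift masks, prefix pruning for twenty-two- and twenty-threefold sums, unpacking of `Multiset` sums of card `22`, `23`.
Nothing here bears on the crux, the doors, or `VP ≠ VNP`.
[folklore] Elementary bit bookkeeping (`Nat.testBit`); no citation is load-bearing.
-/

-- `Summit.ValiantsHypothesis.ValiantsHypothesis.…` repeats a component by the D-0017 layout
-- (single-conjunct summit), which the `dupNamespace` linter flags; the name is mandated.
set_option linter.dupNamespace false

namespace Summit.ValiantsHypothesis.ValiantsHypothesis.Theorems.LacunarySymmetroidMatrixDescartes.FiniteSector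

/-- **Twenty-twofold sum ⇒ bit** of the 22-fold shift mask. [folklore] -/
theorem testBit_fold22Shift_of_mem {l : List ℕ} {r : ℕ}
    (h : ∃ x ∈ l, ∃ y ∈ l, ∃ z ∈ l, ∃ w ∈ l, ∃ v ∈ l, ∃ o ∈ l, ∃ t ∈ l, ∃ e₁ ∈ l, ∃ e₂ ∈ l, ∃ e₃ ∈ l, ∃ e₄ ∈ l, ∃ e₅ ∈ l, ∃ e₆ ∈ l, ∃ e₇ ∈ l, ∃ e₈ ∈ l, ∃ e₉ ∈ l, ∃ e₁₀ ∈ l, ∃ e₁₁ ∈ l, ∃ e₁₂ ∈ l, ∃ e₁₃ ∈ l, ∃ e₁₄ ∈ l, ∃ e₁₅ ∈ l, x + y + z + w + v + o + t + e₁ + e₂ + e₃ + e₄ + e₅ + e₆ + e₇ + e₈ + e₉ + e₁₀ + e₁₁ + e₁₂ + e₁₃ + e₁₄ + e₁₅ = r) :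
    (List.foldr (fun (x acc : ℕ) => acc ||| (List.foldr (fun (x acc : ℕ) => acc ||| (List.foldr (fun (x acc : ℕ) => acc ||| (List.foldr (fun (x acc : ℕ) => acc ||| (List.foldr (fun (x acc : ℕ) => acc ||| (List.foldr (fun (x acc : ℕ) => acc ||| (List.foldr (fun (x acc : ℕ) => acc ||| (List.foldr (fun (x acc : ℕ) => acc ||| (List.foldr (fun (x acc : ℕ) => acc ||| (List.foldr (fun (x acc : ℕ) => acc ||| (List.foldr (fun (x acc : ℕ) => acc ||| (List.foldr (fun (x acc : ℕ) => acc ||| (List.foldr (fun (x acc : ℕ) => acc ||| (List.foldr (fun (x acc : ℕ) => acc ||| (List.foldr (fun (x acc : ℕ) => acc ||| (List.foldr (fun (x acc : ℕ) => acc ||| (List.foldr (fun (x acc : ℕ) => acc ||| (List.foldr (fun (x acc : ℕ) => acc ||| (List.foldr (fun (x acc : ℕ) => acc ||| (List.foldr (fun (x acc : ℕ) => acc ||| (List.foldr (fun (x acc : ℕ) => acc ||| (List.foldr (fun (y acc : ℕ) => acc ||| 2 ^ y) 0 l) * 2 ^ x) 0 l) * 2 ^ x) 0 l) * 2 ^ x)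 0 l) * 2 ^ x) 0 l) * 2 ^ x) 0 l) * 2 ^ x) 0 l) * 2 ^ x) 0 l) * 2 ^ x) 0 l) * 2 ^ x) 0 l) * 2 ^ x) 0 l) * 2 ^ x) 0 l) * 2 ^ x) 0 l) * 2 ^ x) 0 l) * 2 ^ x) 0 l) * 2 ^ x) 0 l) * 2 ^ x) 0 l) * 2 ^ x) 0 l) * 2 ^ x) 0 l) * 2 ^ x) 0 l) * 2 ^ x) 0 l) * 2 ^ x) 0 l).testBit r = true := by
  rw [testBit_shiftFold]
  obtain ⟨x, hx, y, hy, z, hz, w, hw, v, hv, o, ho, t, ht, e₁, he₁, e₂, he₂, e₃, he₃, e₄, he₄, e₅, he₅, e₆, he₆, e₇, he₇, e₈, he₈, e₉, he₉, e₁₀, he₁₀, e₁₁, he₁₁, e₁₂, he₁₂, e₁₃, he₁₃, e₁₄, he₁₄, e₁₅, he₁₅, hs⟩ := h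
  refine Or.inr ⟨x, hx, by omega, ?_⟩
  have : r - x = y + z + w + v + o + t + e₁ + e₂ + e₃ + e₄ + e₅ + e₆ + e₇ + e₈ + e₉ + e₁₀ + e₁₁ + e₁₂ + e₁₃ + e₁₄ + e₁₅ := by omega
  rw [this]
  exact testBit_fold21Shift_of_mem ⟨y, hy, z, hz, w, hw, v, hv, o, ho, t, ht, e₁, he₁, e₂, he₂, e₃, he₃, e₄, he₄, e₅, he₅, e₆, he₆, e₇, he₇, e₈, he₈, e₉, he₉, e₁₀, he₁₀, e₁₁, he₁₁, e₁₂, he₁₂, e₁₃, he₁₃, e₁₄, he₁₄, e₁₅, he₁₅, rfl⟩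

/-- **Twenty-threefold sum ⇒ bit** of the 23-fold shift mask. [folklore] -/
theorem testBit_fold23Shift_of_mem {l : List ℕ} {r : ℕ}
    (h : ∃ x ∈ l, ∃ y ∈ l, ∃ z ∈ l, ∃ w ∈ l, ∃ v ∈ l, ∃ o ∈ l, ∃ t ∈ l, ∃ e₁ ∈ l, ∃ e₂ ∈ l, ∃ e₃ ∈ l, ∃ e₄ ∈ l, ∃ e₅ ∈ l, ∃ e₆ ∈ l, ∃ e₇ ∈ l, ∃ e₈ ∈ l, ∃ e₉ ∈ l, ∃ e₁₀ ∈ l, ∃ e₁₁ ∈ l, ∃ e₁₂ ∈ l, ∃ e₁₃ ∈ l, ∃ e₁₄ ∈ l, ∃ e₁₅ ∈ l, ∃ e₁₆ ∈ l, x + y + z + w + v + o + t + e₁ + e₂ + e₃ + e₄ + e₅ + e₆ + e₇ + e₈ + e₉ + e₁₀ + e₁₁ + e₁₂ + e₁₃ + e₁₄ + e₁₅ + e₁₆ = r) :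
    (List.foldr (fun (x acc : ℕ) => acc ||| (List.foldr (fun (x acc : ℕ) => acc ||| (List.foldr (fun (x acc : ℕ) => acc ||| (List.foldr (fun (x acc : ℕ) => acc ||| (List.foldr (fun (x acc : ℕ) => acc ||| (List.foldr (fun (x acc : ℕ) => acc ||| (List.foldr (fun (x acc : ℕ) => acc ||| (List.foldr (fun (x acc : ℕ) => acc ||| (List.foldr (fun (x acc : ℕ) => acc ||| (List.foldr (fun (x acc : ℕ) => acc ||| (List.foldr (fun (x acc : ℕ) => acc ||| (List.foldr (fun (x acc : ℕ) => acc ||| (List.foldr (fun (x acc : ℕ) => acc ||| (List.foldr (fun (x acc : ℕ) => acc ||| (List.foldr (fun (x acc : ℕ) => acc ||| (List.foldr (fun (x acc : ℕ) => acc ||| (List.foldr (fun (x acc : ℕ) => acc ||| (List.foldr (fun (x acc : ℕ) => acc ||| (List.foldr (fun (x acc : ℕ) => acc ||| (List.foldr (fun (x acc : ℕ) => acc ||| (List.foldr (fun (x acc : ℕ) => acc ||| (List.foldr (fun (x acc : ℕ) => acc ||| (List.foldr (fun (y acc : ℕ) => acc ||| 2 ^ y) 0 l) * 2 ^ x) 0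 l) * 2 ^ x) 0 l) * 2 ^ x) 0 l) * 2 ^ x) 0 l) * 2 ^ x) 0 l) * 2 ^ x) 0 l) * 2 ^ x) 0 l) * 2 ^ x) 0 l) * 2 ^ x) 0 l) * 2 ^ x) 0 l) * 2 ^ x) 0 l) * 2 ^ x) 0 l) * 2 ^ x) 0 l) * 2 ^ x) 0 l) * 2 ^ x) 0 l) * 2 ^ x) 0 l) * 2 ^ x) 0 l) * 2 ^ x) 0 l) * 2 ^ x) 0 l) * 2 ^ x) 0 l) * 2 ^ x) 0 l) * 2 ^ x) 0 l).testBit r = true := by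
  rw [testBit_shiftFold]
  obtain ⟨x, hx, y, hy, z, hz, w, hw, v, hv, o, ho, t, ht, e₁, he₁, e₂, he₂, e₃, he₃, e₄, he₄, e₅, he₅, e₆, he₆, e₇, he₇, e₈, he₈, e₉, he₉, e₁₀, he₁₀, e₁₁, he₁₁, e₁₂, he₁₂, e₁₃, he₁₃, e₁₄, he₁₄, e₁₅, he₁₅, e₁₆, he₁₆, hs⟩ := h
  refine Or.inr ⟨x, hx, by omega, ?_⟩
  have : r - x = y + z + w + v + o + t + e₁ + e₂ + e₃ + e₄ + e₅ + e₆ + e₇ + e₈ + e₉ + e₁₀ + e₁₁ + e₁₂ + e₁₃ + e₁₄ + e₁₅ + e₁₆ := by omega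
  rw [this]
  exact testBit_fold22Shift_of_mem ⟨y, hy, z, hz, w, hw, v, hv, o, ho, t, ht, e₁, he₁, e₂, he₂, e₃, he₃, e₄, he₄, e₅, he₅, e₆, he₆, e₇, he₇, e₈, he₈, e₉, he₉, e₁₀, he₁₀, e₁₁, he₁₁, e₁₂, he₁₂, e₁₃, he₁₃, e₁₄, he₁₄, e₁₅, he₁₅, e₁₆, he₁₆, rfl⟩

/-- If every element of `l₂` is `≥ x`, a twenty-twofold sum `r < x` of `l₁ ++ l₂` is already one of `l₁`. [folklore] -/
theorem memP22_prefix {l₁ l₂ : List ℕ} {x r : ℕ} (hx : ∀ y ∈ l₂, x ≤ y) (hr : r < x) :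
    (∃ p ∈ l₁ ++ l₂, ∃ q ∈ l₁ ++ l₂, ∃ s ∈ l₁ ++ l₂, ∃ t ∈ l₁ ++ l₂, ∃ u ∈ l₁ ++ l₂, ∃ v ∈ l₁ ++ l₂, ∃ w ∈ l₁ ++ l₂, ∃ p₁ ∈ l₁ ++ l₂, ∃ q₁ ∈ l₁ ++ l₂, ∃ r₁ ∈ l₁ ++ l₂, ∃ s₁ ∈ l₁ ++ l₂, ∃ t₁ ∈ l₁ ++ l₂, ∃ u₁ ∈ l₁ ++ l₂, ∃ v₁ ∈ l₁ ++ l₂, ∃ w₁ ∈ l₁ ++ l₂, ∃ p₂ ∈ l₁ ++ l₂, ∃ q₂ ∈ l₁ ++ l₂, ∃ r₂ ∈ l₁ ++ l₂, ∃ s₂ ∈ l₁ ++ l₂, ∃ t₂ ∈ l₁ ++ l₂, ∃ u₂ ∈ l₁ ++ l₂, ∃ v₂ ∈ l₁ ++ l₂, p + q + s + t + u + v + w + p₁ + q₁ + r₁ + s₁ + t₁ + u₁ + v₁ + w₁ + p₂ + q₂ + r₂ + s₂ + t₂ + u₂ + v₂ = r) →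
      (∃ p ∈ l₁, ∃ q ∈ l₁, ∃ s ∈ l₁, ∃ t ∈ l₁, ∃ u ∈ l₁, ∃ v ∈ l₁, ∃ w ∈ l₁, ∃ p₁ ∈ l₁, ∃ q₁ ∈ l₁, ∃ r₁ ∈ l₁, ∃ s₁ ∈ l₁, ∃ t₁ ∈ l₁, ∃ u₁ ∈ l₁, ∃ v₁ ∈ l₁, ∃ w₁ ∈ l₁, ∃ p₂ ∈ l₁, ∃ q₂ ∈ l₁, ∃ r₂ ∈ l₁, ∃ s₂ ∈ l₁, ∃ t₂ ∈ l₁, ∃ u₂ ∈ l₁, ∃ v₂ ∈ l₁, p + q + s + t + u + v + w + p₁ + q₁ + r₁ + s₁ + t₁ + u₁ + v₁ + w₁ + p₂ + q₂ + r₂ + s₂ + t₂ + u₂ + v₂ = r) := by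
  rintro ⟨p, hp, q, hq, s, hs, t, ht, u, hu, v, hv, w, hw, p₁, hp₁, q₁, hq₁, r₁, hr₁, s₁, hs₁, t₁, ht₁, u₁, hu₁, v₁, hv₁, w₁, hw₁, p₂, hp₂, q₂, hq₂, r₂, hr₂, s₂, hs₂, t₂, ht₂, u₂, hu₂, v₂, hv₂, hsum⟩
  rw [List.mem_append] at hp hq hs ht hu hv hw hp₁ hq₁ hr₁ hs₁ ht₁ hu₁ hv₁ hw₁ hp₂ hq₂ hr₂ hs₂ ht₂ hu₂ hv₂
  rcases hp with hp | hp
  · rcases hq with hq | hq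
    · rcases hs with hs | hs
      · rcases ht with ht | ht
        · rcases hu with hu | hu
          · rcases hv with hv | hv
            · rcases hw with hw | hw
              · rcases hp₁ with hp₁ | hp₁
                · rcases hq₁ with hq₁ | hq₁
                  · rcases hr₁ with hr₁ | hr₁
                    · rcases hs₁ with hs₁ | hs₁
                      · rcases ht₁ with ht₁ | ht₁
                        · rcases hu₁ with hu₁ | hu₁
                          · rcases hv₁ with hv₁ | hv₁
                            · rcases hw₁ with hw₁ | hw₁
                              · rcases hp₂ with hp₂ | hp₂
                                · rcases hq₂ with hq₂ | hq₂
                                  · rcases hr₂ with hr₂ | hr₂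
                                    · rcases hs₂ with hs₂ | hs₂
                                      · rcases ht₂ with ht₂ | ht₂
                                        · rcases hu₂ with hu₂ | hu₂
                                          · rcases hv₂ with hv₂ | hv₂
                                            · exact ⟨p, hp, q, hq, s, hs, t, ht, u, hu, v, hv, w, hw, p₁, hp₁, q₁, hq₁, r₁, hr₁, s₁, hs₁, t₁, ht₁, u₁, hu₁, v₁, hv₁, w₁, hw₁, p₂, hp₂, q₂, hq₂, r₂, hr₂, s₂, hs₂, t₂, ht₂, u₂, hu₂, v₂, hv₂, hsum⟩
                                            · have := hx v₂ hv₂; omega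
                                          · have := hx u₂ hu₂; omega
                                        · have := hx t₂ ht₂; omega
                                      · have := hx s₂ hs₂; omega
                                    · have := hx r₂ hr₂; omega
                                  · have := hx q₂ hq₂; omega
                                · have := hx p₂ hp₂; omega
                              · have := hx w₁ hw₁; omega
                            · have := hx v₁ hv₁; omega
                          · have := hx u₁ hu₁; omega
                        · have := hx t₁ ht₁; omega
                      · have := hx s₁ hs₁; omega
                    · have := hx r₁ hr₁; omega
                  · have := hx q₁ hq₁; omega
                · have := hx p₁ hp₁; omega
              · have := hx w hw; omega
            · have := hx v hv; omega
          · have := hx u hu; omega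
        · have := hx t ht; omega
      · have := hx s hs; omega
    · have := hx q hq; omega
  · have := hx p hp; omega

/-- If every element of `l₂` is `≥ x`, a twenty-threefold sum `r < x` of `l₁ ++ l₂` is already one of `l₁`. [folklore] -/
theorem memP23_prefix {l₁ l₂ : List ℕ} {x r : ℕ} (hx : ∀ y ∈ l₂, x ≤ y) (hr : r < x) :
    (∃ p ∈ l₁ ++ l₂, ∃ q ∈ l₁ ++ l₂, ∃ s ∈ l₁ ++ l₂, ∃ t ∈ l₁ ++ l₂, ∃ u ∈ l₁ ++ l₂, ∃ v ∈ l₁ ++ l₂, ∃ w ∈ l₁ ++ l₂, ∃ p₁ ∈ l₁ ++ l₂, ∃ q₁ ∈ l₁ ++ l₂, ∃ r₁ ∈ l₁ ++ l₂, ∃ s₁ ∈ l₁ ++ l₂, ∃ t₁ ∈ l₁ ++ l₂, ∃ u₁ ∈ l₁ ++ l₂, ∃ v₁ ∈ l₁ ++ l₂, ∃ w₁ ∈ l₁ ++ l₂, ∃ p₂ ∈ l₁ ++ l₂, ∃ q₂ ∈ l₁ ++ l₂, ∃ r₂ ∈ l₁ ++ l₂, ∃ s₂ ∈ l₁ ++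 l₂, ∃ t₂ ∈ l₁ ++ l₂, ∃ u₂ ∈ l₁ ++ l₂, ∃ v₂ ∈ l₁ ++ l₂, ∃ w₂ ∈ l₁ ++ l₂, p + q + s + t + u + v + w + p₁ + q₁ + r₁ + s₁ + t₁ + u₁ + v₁ + w₁ + p₂ + q₂ + r₂ + s₂ + t₂ + u₂ + v₂ + w₂ = r) →
      (∃ p ∈ l₁, ∃ q ∈ l₁, ∃ s ∈ l₁, ∃ t ∈ l₁, ∃ u ∈ l₁, ∃ v ∈ l₁, ∃ w ∈ l₁, ∃ p₁ ∈ l₁, ∃ q₁ ∈ l₁, ∃ r₁ ∈ l₁, ∃ s₁ ∈ l₁, ∃ t₁ ∈ l₁, ∃ u₁ ∈ l₁, ∃ v₁ ∈ l₁, ∃ w₁ ∈ l₁, ∃ p₂ ∈ l₁, ∃ q₂ ∈ l₁, ∃ r₂ ∈ l₁, ∃ s₂ ∈ l₁, ∃ t₂ ∈ l₁, ∃ u₂ ∈ l₁, ∃ v₂ ∈ l₁, ∃ w₂ ∈ l₁, p + q + s + t + u + v + w + p₁ + q₁ + r₁ + s₁ + t₁ + u₁ + v₁ + w₁ + p₂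 + q₂ + r₂ + s₂ + t₂ + u₂ + v₂ + w₂ = r) := by
  rintro ⟨p, hp, q, hq, s, hs, t, ht, u, hu, v, hv, w, hw, p₁, hp₁, q₁, hq₁, r₁, hr₁, s₁, hs₁, t₁, ht₁, u₁, hu₁, v₁, hv₁, w₁, hw₁, p₂, hp₂, q₂, hq₂, r₂, hr₂, s₂, hs₂, t₂, ht₂, u₂, hu₂, v₂, hv₂, w₂, hw₂, hsum⟩
  rw [List.mem_append] at hp hq hs ht hu hv hw hp₁ hq₁ hr₁ hs₁ ht₁ hu₁ hv₁ hw₁ hp₂ hq₂ hr₂ hs₂ ht₂ hu₂ hv₂ hw₂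
  rcases hp with hp | hp
  · rcases hq with hq | hq
    · rcases hs with hs | hs
      · rcases ht with ht | ht
        · rcases hu with hu | hu
          · rcases hv with hv | hv
            · rcases hw with hw | hw
              · rcases hp₁ with hp₁ | hp₁
                · rcases hq₁ with hq₁ | hq₁
                  · rcases hr₁ with hr₁ | hr₁
                    · rcases hs₁ with hs₁ | hs₁
                      · rcases ht₁ with ht₁ | ht₁
                        · rcases hu₁ with hu₁ | hu₁
                          · rcases hv₁ with hv₁ | hv₁
                            · rcases hw₁ with hw₁ | hw₁
                              · rcases hp₂ with hp₂ | hp₂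
                                · rcases hq₂ with hq₂ | hq₂
                                  · rcases hr₂ with hr₂ | hr₂
                                    · rcases hs₂ with hs₂ | hs₂
                                      · rcases ht₂ with ht₂ | ht₂
                                        · rcases hu₂ with hu₂ | hu₂
                                          · rcases hv₂ with hv₂ | hv₂
                                            · rcases hw₂ with hw₂ | hw₂
                                              · exact ⟨p, hp, q, hq, s, hs, t, ht, u, hu, v, hv, w, hw, p₁, hp₁, q₁, hq₁, r₁, hr₁, s₁, hs₁, t₁, ht₁, u₁, hu₁, v₁, hv₁, w₁, hw₁, p₂, hp₂, q₂, hq₂, r₂, hr₂, s₂, hs₂, t₂, ht₂, u₂, hu₂, v₂, hv₂, w₂, hw₂, hsum⟩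
                                              · have := hx w₂ hw₂; omega
                                            · have := hx v₂ hv₂; omega
                                          · have := hx u₂ hu₂; omega
                                        · have := hx t₂ ht₂; omega
                                      · have := hx s₂ hs₂; omega
                                    · have := hx r₂ hr₂; omega
                                  · have := hx q₂ hq₂; omega
                                · have := hx p₂ hp₂; omega
                              · have := hx w₁ hw₁; omega
                            · have := hx v₁ hv₁; omega
                          · have := hx u₁ hu₁; omega
                        · have := hx t₁ ht₁; omega
                      · have := hx s₁ hs₁; omega
                    · have := hx r₁ hr₁; omega
                  · have := hx q₁ hq₁; omega
                · have := hx p₁ hp₁; omega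
              · have := hx w hw; omega
            · have := hx v hv; omega
          · have := hx u hu; omega
        · have := hx t ht; omega
      · have := hx s hs; omega
    · have := hx q hq; omega
  · have := hx p hp; omega

/-- A multiset of card `22` of indices has value sum `d i + d j + d k + d l + d n + d o + d q + d i₁ + d j₁ + d k₁ + d l₁ + d n₁ + d o₁ + d q₁ + d i₂ + d j₂ + d k₂ + d l₂ + d n₂ + d o₂ + d q₂ + d i₃`. [folklore] -/
theorem exists_sum_eq_of_card_twentytwo {K : ℕ} (d : Fin K → ℕ) (s : Multiset (Fin K)) (hs : Multiset.card s = 22) :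
    ∃ i j k l n o q i₁ j₁ k₁ l₁ n₁ o₁ q₁ i₂ j₂ k₂ l₂ n₂ o₂ q₂ i₃ : Fin K, (s.map d).sum = d i + d j + d k + d l + d n + d o + d q + d i₁ + d j₁ + d k₁ + d l₁ + d n₁ + d o₁ + d q₁ + d i₂ + d j₂ + d k₂ + d l₂ + d n₂ + d o₂ + d q₂ + d i₃ := by
  obtain ⟨a, t, rfl⟩ : ∃ a t, s = a ::ₘ t := by
    rcases Multiset.empty_or_exists_mem s with h | ⟨a, ha⟩
    · rw [h] at hs; simp at hs
    · exact ⟨a, s.erase a, (Multiset.cons_erase ha).symm⟩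
  rw [Multiset.card_cons] at hs
  obtain ⟨i, j, k, l, n, o, q, i₁, j₁, k₁, l₁, n₁, o₁, q₁, i₂, j₂, k₂, l₂, n₂, o₂, q₂, h21⟩ := exists_sum_eq_of_card_twentyone d t (by omega)
  refine ⟨a, i, j, k, l, n, o, q, i₁, j₁, k₁, l₁, n₁, o₁, q₁, i₂, j₂, k₂, l₂, n₂, o₂, q₂, ?_⟩
  rw [Multiset.map_cons, Multiset.sum_cons, h21]
  ring

/-- A multiset of card `23` of indices has value sum `d i + d j + d k + d l + d n + d o + d q + d i₁ + d j₁ + d k₁ + d l₁ + d n₁ + d o₁ + d q₁ + d i₂ + d j₂ + d k₂ + d l₂ + d n₂ + d o₂ + d q₂ + d i₃ + d j₃`. [folklore] -/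
theorem exists_sum_eq_of_card_twentythree {K : ℕ} (d : Fin K → ℕ) (s : Multiset (Fin K)) (hs : Multiset.card s = 23) :
    ∃ i j k l n o q i₁ j₁ k₁ l₁ n₁ o₁ q₁ i₂ j₂ k₂ l₂ n₂ o₂ q₂ i₃ j₃ : Fin K, (s.map d).sum = d i + d j + d k + d l + d n + d o + d q + d i₁ + d j₁ + d k₁ + d l₁ + d n₁ + d o₁ + d q₁ + d i₂ + d j₂ + d k₂ + d l₂ + d n₂ + d o₂ + d q₂ + d i₃ + d j₃ := by
  obtain ⟨a, t, rfl⟩ : ∃ a t, s = a ::ₘ t := by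
    rcases Multiset.empty_or_exists_mem s with h | ⟨a, ha⟩
    · rw [h] at hs; simp at hs
    · exact ⟨a, s.erase a, (Multiset.cons_erase ha).symm⟩
  rw [Multiset.card_cons] at hs
  obtain ⟨i, j, k, l, n, o, q, i₁, j₁, k₁, l₁, n₁, o₁, q₁, i₂, j₂, k₂, l₂, n₂, o₂, q₂, i₃, h22⟩ := exists_sum_eq_of_card_twentytwo d t (by omega)
  refine ⟨a, i, j, k, l, n, o, q, i₁, j₁, k₁, l₁, n₁, o₁, q₁, i₂, j₂, k₂, l₂, n₂, o₂, q₂, i₃, ?_⟩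
  rw [Multiset.map_cons, Multiset.sum_cons, h22]
  ring

end Summit.ValiantsHypothesis.ValiantsHypothesis.Theorems.LacunarySymmetroidMatrixDescartes.FiniteSector
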